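import Mathlib
import HarnessLib
import Summits.ResolutionOfSingularities.ResolutionOfSingularities.Theorems.WildQuotientsWildQuotientResolutionEigenlineChartFractions

/-!
# The equivariant quadratic transform along a stable tangent hyperplane: the `H`-fixed closed point `[W]` of the
# point blow-up and its residue-trivial `H`-action (Kollár–Szabó going down, step (K2), local form)
# (crux `WildQuotients.WildQuotientResolution`, stub `stub_phaseZeroHighDim`)

Crux stmt-ResolutionOfSingularities-15640 (`WildQuotientResolution`), registered stub `stub_phaseZeroHighDim`.
Memo PHASE0-KS-EIGENLINE (hand leafhand-res-wildquotients-8 g0) lists, for the blow-up-tower instance of the named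
fact `KollarSzaboGoingDown` (Reichstein–Youssin 2000, App., Prop. A.2; the hypothesis of the negative side-lemma
✓`StandardForm.not_primeOrbitSeparation_of_commuting_conjugates`, p824255): (K2) the `H`-FIXED CLOSED POINT of the
point blow-up in the chart `D₊(t)`, `𝔫 = 𝔪·S[𝔪/t] + (W/t)·S[𝔪/t]` for the `H`-stable tangent hyperplane
`𝔪² ≤ W < 𝔪` with unit eigenvalue on `𝔪/W` (✓`AbelianEigenline.exists_stable_tangentHyperplane`,
✓`exists_unit_mul_sub_mem_of_not_mem`, p826834). With ✓`EigenlineChartOrigin` (p827786: `𝔫` exists and is maximal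
with residue field `κ(S)` when `S` is REGULAR; `S[𝔪/t]_𝔫` is a quadratic transform) and ✓`EigenlineChartFractions`,
this file proves the EQUIVARIANCE in the tree's `Subring K` vocabulary (`QuadraticTransforms.lean`):

* `sigma_mem_ofPrime_of_mem_blowupRing` — for an automorphism `σ` of `K` preserving `S`, residue-trivial on `S`,
  with `σ x_j ∈ W` (`j ≠ i`) and `σ x_i ≡ u x_i (mod W)`, `u` a unit: `σ (S[𝔪/x_i]) ⊆ S[𝔪/x_i]_𝔫` and
  `σ z ≡ z` modulo the maximal ideal (key identity `σ x_i = x_i · (u + w/x_i)`, `u + w/x_i ∉ 𝔫`);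
* `exists_rsop_adapted_to_hyperplane` — coordinates adapted to a hyperplane `𝔪² ≤ W`, `W + (t) = 𝔪` (a regular system
  of parameters with `x_i = t`, `x_j ∈ W`, `W ≤ (x_j : j ≠ i) + 𝔪²`), bridging the eigenline output to this input;
* `exists_equivariant_quadraticTransform` — ★ the quadratic transform `R₁ = S[𝔪/x_i]_𝔫` of `S` is `σ_h`-STABLE for
  every member of the family, the induced action is again RESIDUE-TRIVIAL, and `R₁` has the SAME RESIDUE FIELD as
  `S`; `x_i`, `x_j/x_i` are non-units of `R₁`. Hence the hypotheses reproduce on `R₁` (regular again, tree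
  ✓`isRegularRing_blowupRing`) and the fixed point climbs any tower of point blow-ups.

[OURS · crux stmt-ResolutionOfSingularities-15640 · helper toward `stub_phaseZeroHighDim` (step (K2) of the
Kollár–Szabó going-down tower instance, local form; NOT a proof of the stub, NOT the scheme-level statement, NOT the
discharge of `KollarSzaboGoingDown`); folklore local algebra after [RY2000, App.], counted 0; AI-level work, weaker
than expert review.]
-/

-- single-problem summit: the doubled namespace component `ResolutionOfSingularities` is forced
set_option linter.dupNamespace false

noncomputable section

namespace Summit.ResolutionOfSingularities.ResolutionOfSingularities.Theorems.WildQuotientResolution.EigenlineChart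

open IsLocalRing Literature.AlgebraicGeometry.Resolution

universe u

section Equivariant

variable {K : Type u} [Field K]

/-- **The chart ring moves into `S[𝔪/x_i]_𝔫`, residue-trivially.** Let `S ⊆ K` be a local subring, `x` generators
of `𝔪` with `x_i ≠ 0`, `𝔫` a prime of the chart `S[𝔪/x_i]` over `𝔪` containing the `x_j/x_i` (`j ≠ i`), and
`W ≤ (x_j : j ≠ i) + 𝔪²`. Let `σ` be an automorphism of `K` preserving `S`, RESIDUE-TRIVIAL on `S`
(`σ s ≡ s mod 𝔪`), with `σ x_j ∈ W` for `j ≠ i` and `σ x_i ≡ u·x_i (mod W)` for a unit `u` (the output of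
✓`AbelianEigenline.exists_stable_tangentHyperplane` / `exists_unit_mul_sub_mem_of_not_mem` for an adapted regular
system of parameters). Then for every `z ∈ S[𝔪/x_i]`: `σ z ∈ S[𝔪/x_i]_𝔫` and `σ z - z = b/s` with `b ∈ 𝔫`,
`s ∉ 𝔫` (so `σ z ≡ z` modulo the maximal ideal of `S[𝔪/x_i]_𝔫`). Key computation: `σ x_i = x_i · c` with
`c = u + w/x_i ∈ S[𝔪/x_i] ∖ 𝔫`, and `σ (x_j/x_i) = (σ x_j / x_i)/c` with `σ x_j / x_i ∈ 𝔫`. [folklore] -/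
theorem sigma_mem_ofPrime_of_mem_blowupRing (S : Subring K) [IsLocalRing S] {d : ℕ} (x : Fin d → S)
    (hx : Ideal.span (Set.range x) = maximalIdeal S) (i : Fin d) (hxi : x i ≠ 0)
    (𝔫 : Ideal (blowupRing S ((x i : S) : K))) [h𝔫 : 𝔫.IsPrime]
    (hnj : ∀ j : Fin d, j ≠ i → ∀ hB : ((x j : S) : K) / ((x i : S) : K) ∈ blowupRing S ((x i : S) : K),
      (⟨_, hB⟩ : blowupRing S ((x i : S) : K)) ∈ 𝔫)
    (hover : ∀ s : S, (⟨(s : K), le_blowupRing S _ s.2⟩ : blowupRing S ((x i : S) : K)) ∈ 𝔫 ↔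
      s ∈ maximalIdeal S)
    {W : Ideal S} (hWle : W ≤ Ideal.span (x '' {j | j ≠ i}) ⊔ maximalIdeal S ^ 2)
    (σ : K ≃+* K) (hσS : ∀ s ∈ S, σ s ∈ S)
    (hres : ∀ s : S, (⟨σ s, hσS s s.2⟩ : S) - s ∈ maximalIdeal S)
    (hWσ : ∀ j : Fin d, j ≠ i → (⟨σ ((x j : S) : K), hσS _ (x j).2⟩ : S) ∈ W)
    (ht : ∃ u : S, IsUnit u ∧ (⟨σ ((x i : S) : K), hσS _ (x i).2⟩ : S) - u * x i ∈ W)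
    {z : K} (hz : z ∈ blowupRing S ((x i : S) : K)) :
    σ z ∈ (LocalSubring.ofPrime (blowupRing S ((x i : S) : K)) 𝔫).toSubring ∧
      ∃ b s : blowupRing S ((x i : S) : K), b ∈ 𝔫 ∧ s ∉ 𝔫 ∧ σ z - z = b / s := by
  classical
  have hxm : ∀ j, x j ∈ maximalIdeal S := fun j => hx ▸ Ideal.subset_span ⟨j, rfl⟩
  have hWm : W ≤ maximalIdeal S := le_maximalIdeal_of_le_hyperplane S x hx i hWle
  have ht0 : ((x i : S) : K) ≠ 0 := fun h => hxi (Subtype.ext h)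
  have hBR₁ : blowupRing S ((x i : S) : K) ≤
      (LocalSubring.ofPrime (blowupRing S ((x i : S) : K)) 𝔫).toSubring := LocalSubring.le_ofPrime _ 𝔫
  have hSB : S ≤ blowupRing S ((x i : S) : K) := le_blowupRing S _
  have h1n : (1 : blowupRing S ((x i : S) : K)) ∉ 𝔫 := fun h1 => h𝔫.ne_top ((Ideal.eq_top_iff_one _).mpr h1)
  -- fractions `b/s`, `b ∈ 𝔫`, `s ∉ 𝔫`: members of `𝔫` qualify
  have hfrac_of_mem : ∀ {y : K} (hyB : y ∈ blowupRing S ((x i : S) : K)),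
      (⟨y, hyB⟩ : blowupRing S ((x i : S) : K)) ∈ 𝔫 →
      ∃ b s : blowupRing S ((x i : S) : K), b ∈ 𝔫 ∧ s ∉ 𝔫 ∧ y = b / s :=
    fun hyB hy => ⟨_, 1, hy, h1n, by simp⟩
  have hfrac_zero : ∃ b s : blowupRing S ((x i : S) : K), b ∈ 𝔫 ∧ s ∉ 𝔫 ∧ (0 : K) = b / s :=
    ⟨0, 1, 𝔫.zero_mem, h1n, by simp⟩
  -- `σ x_i = x_i · c`, `c = u + w₀/x_i ∉ 𝔫`
  obtain ⟨u, hu, huW⟩ := ht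
  set w₀ : S := (⟨σ ((x i : S) : K), hσS _ (x i).2⟩ : S) - u * x i with hw₀
  have hw₀B : (w₀ : K) / ((x i : S) : K) ∈ blowupRing S ((x i : S) : K) := div_mem_blowupRing _ (hWm huW)
  have hw₀n : (⟨_, hw₀B⟩ : blowupRing S ((x i : S) : K)) ∈ 𝔫 :=
    div_mem_chartOrigin_of_mem S x hx i 𝔫 hnj (fun s hs => (hover s).mpr hs) hWle huW hw₀B
  have hcB : (u : K) + (w₀ : K) / ((x i : S) : K) ∈ blowupRing S ((x i : S) : K) :=
    add_mem (hSB u.2) hw₀B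
  have hc : (⟨_, hcB⟩ : blowupRing S ((x i : S) : K)) ∉ 𝔫 := by
    intro hc
    have hu' : (⟨(u : K), hSB u.2⟩ : blowupRing S ((x i : S) : K)) ∈ 𝔫 := by
      have e : (⟨(u : K), hSB u.2⟩ : blowupRing S ((x i : S) : K)) = ⟨_, hcB⟩ - ⟨_, hw₀B⟩ :=
        Subtype.ext (by simp)
      rw [e]; exact sub_mem hc hw₀n
    exact (IsLocalRing.mem_maximalIdeal _).mp ((hover u).mp hu') hu
  have hσt : σ ((x i : S) : K) = ((x i : S) : K) * ((u : K) + (w₀ : K) / ((x i : S) : K)) := by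
    have e : (w₀ : K) = σ ((x i : S) : K) - (u : K) * ((x i : S) : K) := by
      rw [hw₀, AddSubgroupClass.coe_sub, Subring.coe_mul]
    rw [e]
    field_simp
    ring
  have hc0 : (u : K) + (w₀ : K) / ((x i : S) : K) ≠ 0 := coe_ne_zero_of_not_mem hc
  -- closure induction over the ring generators `S ∪ {x_j/x_i}`
  rw [blowupRing_eq_closure_of_span_eq ((x i : S) : K) (Set.range x) hx] at hz
  induction hz using Subring.closure_induction with
  | mem z hz =>
    rcases hz with hzS | ⟨y, ⟨j, rfl⟩, rfl⟩
    · -- `z ∈ S`: `σ z ∈ S`, `σ z - z ∈ 𝔪 ⊆ 𝔫`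
      refine ⟨hBR₁ (hSB (hσS z hzS)), ?_⟩
      have hm : (⟨σ z, hσS z hzS⟩ : S) - ⟨z, hzS⟩ ∈ maximalIdeal S := hres ⟨z, hzS⟩
      have hn := (hover _).mpr hm
      exact hfrac_of_mem (hSB ((⟨σ z, hσS z hzS⟩ : S) - ⟨z, hzS⟩).2) hn
    · dsimp only
      by_cases hj : j = i
      · rw [hj, div_self ht0, map_one, sub_self]
        exact ⟨Subring.one_mem _, hfrac_zero⟩
      · -- `σ (x_j/x_i) = (σ x_j / x_i) / c`
        have haB : σ ((x j : S) : K) / ((x i : S) : K) ∈ blowupRing S ((x i : S) : K) :=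
          div_mem_blowupRing _ (hWm (hWσ j hj))
        have han : (⟨_, haB⟩ : blowupRing S ((x i : S) : K)) ∈ 𝔫 :=
          div_mem_chartOrigin_of_mem S x hx i 𝔫 hnj (fun s hs => (hover s).mpr hs) hWle (hWσ j hj) haB
        have hσz : σ (((x j : S) : K) / ((x i : S) : K)) =
            (σ ((x j : S) : K) / ((x i : S) : K)) / ((u : K) + (w₀ : K) / ((x i : S) : K)) := by
          rw [map_div₀, hσt, div_div]
        have hfracσ : ∃ b s : blowupRing S ((x i : S) : K), b ∈ 𝔫 ∧ s ∉ 𝔫 ∧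
            σ (((x j : S) : K) / ((x i : S) : K)) = b / s := ⟨_, _, han, hc, hσz⟩
        refine ⟨mem_ofPrime_of_frac hfracσ, ?_⟩
        exact frac_sub hfracσ (hfrac_of_mem (div_mem_blowupRing _ (hxm j)) (hnj j hj _))
  | zero =>
    rw [map_zero, sub_self]
    exact ⟨Subring.zero_mem _, hfrac_zero⟩
  | one =>
    rw [map_one, sub_self]
    exact ⟨Subring.one_mem _, hfrac_zero⟩
  | add a b ha hb iha ihb =>
    refine ⟨by rw [map_add]; exact add_mem iha.1 ihb.1, ?_⟩
    rw [map_add, show σ a + σ b - (a + b) = (σ a - a) + (σ b - b) by ring]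
    exact frac_add iha.2 ihb.2
  | neg a ha iha =>
    refine ⟨by rw [map_neg]; exact neg_mem iha.1, ?_⟩
    rw [map_neg, show -σ a - -a = -(σ a - a) by ring]
    exact frac_neg iha.2
  | mul a b ha hb iha ihb =>
    have hbB : b ∈ blowupRing S ((x i : S) : K) := by
      rw [blowupRing_eq_closure_of_span_eq ((x i : S) : K) (Set.range x) hx]; exact hb
    refine ⟨by rw [map_mul]; exact mul_mem iha.1 ihb.1, ?_⟩
    rw [map_mul, show σ a * σ b - a * b = σ a * (σ b - b) + (σ a - a) * b by ring]
    exact frac_add (frac_mul_left iha.1 ihb.2) (frac_mul_right iha.2 (hBR₁ hbB))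

/-- **The equivariant quadratic transform along a stable tangent hyperplane (Kollár–Szabó going down, step (K2),
local form).** Let `S ⊆ K` be a REGULAR local subring with regular system of parameters `x`, `x_i ≠ 0`, and
`W ≤ (x_j : j ≠ i) + 𝔪²` an ideal (the stable tangent HYPERPLANE of ✓`AbelianEigenline.exists_stable_tangentHyperplane`
in coordinates adapted to it: `t = x_i ∉ W`, `x_j ∈ W`). Let a family `σ_h` (`h : H`) of automorphisms of `K` preserve
`S`, act RESIDUE-TRIVIALLY on `S`, map the `x_j` (`j ≠ i`) into `W` and satisfy `σ_h x_i ≡ u_h x_i (mod W)` with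
`u_h` a unit (✓`AbelianEigenline.exists_unit_mul_sub_mem_of_not_mem`). Then there is a subring `R₁ ⊆ K` — the local
ring `S[𝔪/x_i]_𝔫` of the point blow-up `Bl_𝔪 Spec S` at the closed point `[W]` of the exceptional divisor
(`exists_chartOrigin`) — which

* is a QUADRATIC TRANSFORM of `S` (`IsQuadraticTransform`; in particular local, dominating `S`), in which `x_i` and
  the `x_j/x_i` (`j ≠ i`) are non-units (`x_i⁻¹ ∉ R₁`, `x_j/x_i ∈ R₁` with inverse outside or zero);
* is `σ_h`-STABLE for every `h` (`σ_h R₁ ⊆ R₁`; equality for a group of automorphisms) — `[W]` is an `H`-FIXED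
  point of the blow-up;
* carries a RESIDUE-TRIVIAL action again: `σ_h z - z` is a non-unit of `R₁` (zero or with inverse outside `R₁`) for
  every `z ∈ R₁`;
* has the SAME RESIDUE FIELD as `S`: every `z ∈ R₁` is congruent to some `s ∈ S` modulo the maximal ideal.

So the hypotheses reproduce themselves on `R₁` (regular again by ✓`isRegularRing_blowupRing`, same dimension, residue
field still algebraically closed) and the construction iterates along a tower of point blow-ups: the local content of
the fixed-point induction in Kollár–Szabó's «going down» (Reichstein–Youssin 2000, App., Prop. A.2) for the tower
instance of the named fact `KollarSzaboGoingDown`. [cite: ReichsteinYoussin2000, Appendix, Prop. A.2]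
[cite: Cutkosky2014, §2.1] -/
theorem exists_equivariant_quadraticTransform (S : Subring K) [IsRegularLocalRing S] {d : ℕ}
    (hd : (maximalIdeal S).spanFinrank = d) (x : Fin d → S)
    (hx : Ideal.span (Set.range x) = maximalIdeal S) (i : Fin d) (hxi : x i ≠ 0)
    {W : Ideal S} (hWle : W ≤ Ideal.span (x '' {j | j ≠ i}) ⊔ maximalIdeal S ^ 2)
    {H : Type*} (σ : H → K ≃+* K) (hσS : ∀ h : H, ∀ s ∈ S, σ h s ∈ S)
    (hres : ∀ (h : H) (s : S), (⟨σ h s, hσS h s s.2⟩ : S) - s ∈ maximalIdeal S)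
    (hWσ : ∀ (h : H) (j : Fin d), j ≠ i → (⟨σ h ((x j : S) : K), hσS h _ (x j).2⟩ : S) ∈ W)
    (ht : ∀ h : H, ∃ u : S, IsUnit u ∧ (⟨σ h ((x i : S) : K), hσS h _ (x i).2⟩ : S) - u * x i ∈ W) :
    ∃ R₁ : Subring K, IsQuadraticTransform S R₁ ∧
      (((x i : S) : K))⁻¹ ∉ R₁ ∧
      (∀ j : Fin d, j ≠ i → ((x j : S) : K) / ((x i : S) : K) ∈ R₁ ∧
        (((x j : S) : K) / ((x i : S) : K) = 0 ∨ (((x j : S) : K) / ((x i : S) : K))⁻¹ ∉ R₁)) ∧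
      (∀ h : H, ∀ z ∈ R₁, σ h z ∈ R₁) ∧
      (∀ h : H, ∀ z ∈ R₁, σ h z - z = 0 ∨ (σ h z - z)⁻¹ ∉ R₁) ∧
      (∀ z ∈ R₁, ∃ s ∈ S, z - s = 0 ∨ (z - s)⁻¹ ∉ R₁) := by
  classical
  have hxm : ∀ j, x j ∈ maximalIdeal S := fun j => hx ▸ Ideal.subset_span ⟨j, rfl⟩
  have ht0 : ((x i : S) : K) ≠ 0 := fun h => hxi (Subtype.ext h)
  obtain ⟨𝔫, hmax, hni, hnj, hover, hcong⟩ := exists_chartOrigin S hd x hx i hxi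
  haveI : 𝔫.IsPrime := hmax.isPrime
  have hBR₁ : blowupRing S ((x i : S) : K) ≤
      (LocalSubring.ofPrime (blowupRing S ((x i : S) : K)) 𝔫).toSubring := LocalSubring.le_ofPrime _ 𝔫
  have hSB : S ≤ blowupRing S ((x i : S) : K) := le_blowupRing S _
  have hnj' : ∀ j : Fin d, j ≠ i → ∀ hB : ((x j : S) : K) / ((x i : S) : K) ∈ blowupRing S ((x i : S) : K),
      (⟨_, hB⟩ : blowupRing S ((x i : S) : K)) ∈ 𝔫 := fun j hj _ => hnj j hj
  -- the claim, for each `σ h`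
  have claim : ∀ (h : H) {z : K}, z ∈ blowupRing S ((x i : S) : K) →
      σ h z ∈ (LocalSubring.ofPrime (blowupRing S ((x i : S) : K)) 𝔫).toSubring ∧
        ∃ b s : blowupRing S ((x i : S) : K), b ∈ 𝔫 ∧ s ∉ 𝔫 ∧ σ h z - z = b / s :=
    fun h z hz => sigma_mem_ofPrime_of_mem_blowupRing S x hx i hxi 𝔫 hnj' hover hWle (σ h) (hσS h)
      (hres h) (hWσ h) (ht h) hz
  refine ⟨(LocalSubring.ofPrime (blowupRing S ((x i : S) : K)) 𝔫).toSubring,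
    isQuadraticTransform_ofPrime_blowupRing S (hxm i) hxi 𝔫 (fun s hs => (hover s).mpr hs),
    ?_, fun j hj => ⟨hBR₁ (div_mem_blowupRing _ (hxm j)), ?_⟩, fun h z hz => ?_, fun h z hz => ?_,
    fun z hz => ?_⟩
  · -- `x_i` is a non-unit
    rcases eq_zero_or_inv_not_mem_of_frac (exists_frac_of_mem hni) with h0 | h
    · exact absurd h0 ht0
    · exact h
  · exact eq_zero_or_inv_not_mem_of_frac (exists_frac_of_mem (hnj j hj))
  · -- stability
    obtain ⟨a, s, hs, rfl⟩ := mem_ofPrime_iff.mp hz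
    have hσs : σ h (s : K) = (s : K) + (σ h (s : K) - s) := by ring
    have hinv : (σ h (s : K))⁻¹ ∈ (LocalSubring.ofPrime (blowupRing S ((x i : S) : K)) 𝔫).toSubring := by
      rw [hσs]
      exact inv_add_mem_ofPrime hs (claim h s.2).2
    rw [map_div₀, div_eq_mul_inv]
    exact mul_mem (claim h a.2).1 hinv
  · -- residue-triviality
    obtain ⟨a, s, hs, rfl⟩ := mem_ofPrime_iff.mp hz
    have hs0 : ((s : blowupRing S ((x i : S) : K)) : K) ≠ 0 := coe_ne_zero_of_not_mem hs
    have hσs0 : σ h (s : K) ≠ 0 := (map_ne_zero_iff _ (σ h).injective).mpr hs0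
    have hσs : σ h (s : K) = (s : K) + (σ h (s : K) - s) := by ring
    have hinv : (σ h (s : K))⁻¹ ∈ (LocalSubring.ofPrime (blowupRing S ((x i : S) : K)) 𝔫).toSubring := by
      rw [hσs]
      exact inv_add_mem_ofPrime hs (claim h s.2).2
    have e : σ h ((a : K) / s) - (a : K) / s =
        ((σ h (a : K) - a) * s - a * (σ h (s : K) - s)) * ((σ h (s : K))⁻¹ * (s : K)⁻¹) := by
      rw [map_div₀]
      field_simp
      ring
    rw [e]
    refine eq_zero_or_inv_not_mem_of_frac (frac_mul_right ?_ (mul_mem hinv (inv_mem_ofPrime hs)))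
    exact frac_sub (frac_mul_right (claim h a.2).2 (hBR₁ s.2)) (frac_mul_left (hBR₁ a.2) (claim h s.2).2)
  · -- same residue field
    obtain ⟨a, s, hs, rfl⟩ := mem_ofPrime_iff.mp hz
    have hs0 : ((s : blowupRing S ((x i : S) : K)) : K) ≠ 0 := coe_ne_zero_of_not_mem hs
    obtain ⟨sa, hsa⟩ := hcong a
    obtain ⟨sb, hsb⟩ := hcong s
    have hsbm : sb ∉ maximalIdeal S := fun hm => by
      have h1 : s ∈ 𝔫 := by
        have e : s = (s - ⟨(sb : K), hSB sb.2⟩) + ⟨(sb : K), hSB sb.2⟩ := by ring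
        rw [e]; exact add_mem hsb ((hover sb).mpr hm)
      exact hs h1
    have hsb0 : (sb : K) ≠ 0 := by
      intro h0
      apply hsbm
      rw [show sb = 0 from Subtype.ext h0]
      exact (maximalIdeal S).zero_mem
    have hsbinv : (sb : K)⁻¹ ∈ S := by
      by_contra hni'
      exact hsbm ((mem_maximalIdeal_iff_inv_not_mem sb).mpr (Or.inr hni'))
    refine ⟨(sa : K) * (sb : K)⁻¹, mul_mem sa.2 hsbinv, ?_⟩
    have e : (a : K) / s - (sa : K) * (sb : K)⁻¹ =
        (((a : K) - sa) * sb - sa * ((s : K) - sb)) * ((s : K)⁻¹ * (sb : K)⁻¹) := by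
      field_simp
      ring
    rw [e]
    refine eq_zero_or_inv_not_mem_of_frac (frac_mul_right ?_ (mul_mem (inv_mem_ofPrime hs) (hBR₁ (hSB hsbinv))))
    refine frac_sub (frac_mul_right (exists_frac_of_mem hsa) (hBR₁ (hSB sb.2)))
      (frac_mul_left (hBR₁ (hSB sa.2)) (exists_frac_of_mem hsb))

/-! ## Coordinates adapted to a tangent hyperplane -/

/-- **A regular system of parameters adapted to a tangent hyperplane.** In a regular local ring `(A, 𝔪)` of
embedding dimension `d`, let `𝔪² ≤ W` be an ideal and `t ∈ 𝔪 ∖ W` with `W + (t) = 𝔪` (a HYPERPLANE of `𝔪/𝔪²`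
through a transversal parameter, the output format of ✓`AbelianEigenline.exists_stable_tangentHyperplane`). Then
there is a regular system of parameters `x` (`(x) = 𝔪`, `d` members) and an index `i` with `x_i = t`, `x_j ∈ W` for
`j ≠ i`, and `W ≤ (x_j : j ≠ i) + 𝔪²` — the input format of `exists_equivariant_quadraticTransform`. Proof: extend
`t ∉ 𝔪²` to a regular system `z` (✓`exists_rsop_apply_eq`, Matsumura Thm. 14.2) and correct each `z_j` by a multiple
of `t` into `W`. [cite: Matsumura1987, Thm. 14.2] -/
theorem exists_rsop_adapted_to_hyperplane {A : Type u} [CommRing A] [IsRegularLocalRing A] {d : ℕ}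
    (hd : (maximalIdeal A).spanFinrank = d) (W : Ideal A) (hW2 : maximalIdeal A ^ 2 ≤ W)
    {t : A} (ht : t ∈ maximalIdeal A) (htW : t ∉ W) (hsup : W ⊔ Ideal.span {t} = maximalIdeal A) :
    ∃ (x : Fin d → A) (i : Fin d), Ideal.span (Set.range x) = maximalIdeal A ∧ x i = t ∧
      (∀ j : Fin d, j ≠ i → x j ∈ W) ∧ W ≤ Ideal.span (x '' {j | j ≠ i}) ⊔ maximalIdeal A ^ 2 := by
  classical
  have ht2 : t ∉ maximalIdeal A ^ 2 := fun h => htW (hW2 h)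
  have hWm : W ≤ maximalIdeal A := le_sup_left.trans hsup.le
  -- `d ≠ 0` since `t ≠ 0` lies in `𝔪`
  have ht0 : t ≠ 0 := fun h => htW (h ▸ W.zero_mem)
  have hd0 : 0 < d := by
    rw [← hd, Nat.pos_iff_ne_zero]
    intro h0
    have hgen := (IsNoetherian.noetherian (maximalIdeal A)).generators_ncard
    rw [h0, Set.ncard_eq_zero (Submodule.FG.finite_generators (IsNoetherian.noetherian _))] at hgen
    have hspan := Submodule.span_generators (maximalIdeal A : Submodule A A)
    rw [hgen, Submodule.span_empty] at hspan
    have htbot : t ∈ (⊥ : Ideal A) := hspan ▸ ht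
    exact ht0 ((Submodule.mem_bot A).mp htbot)
  let i : Fin d := ⟨0, hd0⟩
  obtain ⟨z, hz, hzi⟩ := exists_rsop_apply_eq hd ht ht2 i
  -- correct each `z_j` into `W` by a multiple of `t`
  have hdec : ∀ j : Fin d, ∃ a : A, z j - a * t ∈ W := by
    intro j
    have hzj : z j ∈ W ⊔ Ideal.span {t} := by
      rw [hsup, ← hz]; exact Ideal.subset_span ⟨j, rfl⟩
    obtain ⟨w, hw, c, hc, hwc⟩ := Submodule.mem_sup.mp hzj
    obtain ⟨a, rfl⟩ := Ideal.mem_span_singleton'.mp hc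
    refine ⟨a, ?_⟩
    rw [← hwc, add_sub_cancel_right]
    exact hw
  choose a ha using hdec
  let x : Fin d → A := fun j => if j = i then t else z j - a j * t
  have hxi : x i = t := if_pos rfl
  have hxj : ∀ j : Fin d, j ≠ i → x j = z j - a j * t := fun j hj => if_neg hj
  have hxm : ∀ j, x j ∈ maximalIdeal A := by
    intro j
    by_cases hj : j = i
    · rw [hj, hxi]; exact ht
    · rw [hxj j hj]; exact hWm (ha j)
  have hspan : Ideal.span (Set.range x) = maximalIdeal A := by
    apply le_antisymm
    · rw [Ideal.span_le]
      rintro _ ⟨j, rfl⟩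
      exact hxm j
    · rw [← hz, Ideal.span_le]
      rintro _ ⟨j, rfl⟩
      have hxi' : t ∈ Ideal.span (Set.range x) := hxi ▸ Ideal.subset_span ⟨i, rfl⟩
      by_cases hj : j = i
      · rw [hj, hzi]; exact hxi'
      · have e : z j = x j + a j * t := by rw [hxj j hj]; ring
        rw [SetLike.mem_coe, e]
        exact add_mem (Ideal.subset_span ⟨j, rfl⟩) (Ideal.mul_mem_left _ _ hxi')
  refine ⟨x, i, hspan, hxi, fun j hj => by rw [hxj j hj]; exact ha j, fun w hw => ?_⟩
  -- `w = Σ c_j x_j`; the coefficient of `x_i = t` lies in `𝔪`, else `t ∈ W`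
  have hw' : w ∈ Ideal.span (Set.range x) := hspan ▸ hWm hw
  obtain ⟨c, hc⟩ := Ideal.mem_span_range_iff_exists_fun.mp hw'
  rw [Finset.sum_eq_add_sum_sdiff_singleton_of_mem (Finset.mem_univ i)] at hc
  set r := ∑ j ∈ Finset.univ \ {i}, c j * x j with hr
  have hrspan : r ∈ Ideal.span (x '' {j | j ≠ i}) := by
    refine Ideal.sum_mem _ fun j hj => Ideal.mul_mem_left _ _ (Ideal.subset_span ⟨j, ?_, rfl⟩)
    simpa [Finset.mem_sdiff] using hj
  have hrW : r ∈ W := by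
    refine Ideal.sum_mem _ fun j hj => Ideal.mul_mem_left _ _ ?_
    have hj' : j ≠ i := by simpa [Finset.mem_sdiff] using hj
    rw [hxj j hj']; exact ha j
  have hcit : c i * t ∈ W := by
    have e : c i * t = w - r := by rw [← hc, hxi]; ring
    rw [e]; exact sub_mem hw hrW
  have hcim : c i ∈ maximalIdeal A := by
    by_contra hu
    have hunit : IsUnit (c i) := by
      by_contra hnu
      exact hu ((IsLocalRing.mem_maximalIdeal _).mpr (mem_nonunits_iff.mpr hnu))
    obtain ⟨v, hv⟩ := hunit.exists_left_inv
    have : t ∈ W := by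
      have e : t = v * (c i * t) := by rw [← mul_assoc, hv, one_mul]
      rw [e]; exact Ideal.mul_mem_left _ _ hcit
    exact htW this
  have hcit2 : c i * t ∈ maximalIdeal A ^ 2 := by
    rw [pow_two]; exact Ideal.mul_mem_mul hcim ht
  have e : w = r + c i * x i := by rw [← hc]; ring
  rw [e, hxi]
  exact Submodule.add_mem_sup hrspan hcit2

end Equivariant

end Summit.ResolutionOfSingularities.ResolutionOfSingularities.Theorems.WildQuotientResolution.EigenlineChart

end
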